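import Literature.AlgebraicGeometry.CubicSurfaces.LinesOrthogonalRep
import Literature.NumberTheory.GaloisRepresentations.GaloisRep
import Literature.NumberTheory.GaloisRepresentations.IntegralGaloisAction
import Literature.NumberTheory.GaloisRepresentations.AbsGaloisGroup
import Mathlib.NumberTheory.Cyclotomic.Basic
import Mathlib.NumberTheory.NumberField.Basic
import Mathlib.LinearAlgebra.Matrix.Charpoly.Basic
import Mathlib.Analysis.Complex.Basic
import HarnessLib

/-!
# The occult compatible system of a cubic surface (Allcock–Carlson–Toledo, Achter)

Let `S = {F = 0} ⊆ ℙ³` be a smooth cubic surface over `ℚ` and `T = T_S = {Y³ = F} ⊆ ℙ⁴` the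
**cyclic cubic threefold**, the triple cover of `ℙ³` branched along `S`, with its deck
transformation `σ : Y ↦ ωY` of order `3`; write `𝓔 = ℤ[ω]`, `E = K = ℚ(ω) = CyclotomicField 3 ℚ`,
`θ = ω - ω⁻¹ = √-3`, and `λ₃ = (1 - ω) = (θ)` for the prime of `𝓞_E` above `3` (`𝓞_E/λ₃ = 𝔽₃`).

## The printed results (the "occult Eisenstein lattice")

* [AllcockCarlsonToledo2002, (2.2)]: `H³(T, ℤ)` is free of rank `10`; since `H³(ℙ³, ℤ) = 0`,
  `σ*` fixes no nonzero vector, so `H³(T, ℤ)` is a module over `ℤ[σ]/(σ² + σ + 1) = 𝓔`, free of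
  rank `5`: the lattice `Λ(T)`.
* [AllcockCarlsonToledo2002, (2.3), Lemma 4.1; KudlaRapoport2012, §5 (5.2)]: the cup product `Ω`
  (alternating, unimodular, `Ω(ωx, ωy) = Ω(x, y)`) defines the unimodular `𝓔`-Hermitian form
  `h(x, y) = ½ (Ω(θx, y) + θ Ω(x, y))` on `Λ(T)`.
* [AllcockCarlsonToledo2002, Lemma 2.6 (proof (4.4)); KudlaRapoport2012, §5 "Fact"; Achter2014,
  Lemma 4.3]: `h` has signature `(4, 1)` (the eigenspace of `H³(T, ℂ)` containing `Λ(T)` has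
  Hodge numbers `h^{2,1} = 1`, `h^{1,2} = 4`), hence [AllcockCarlsonToledo2002, (2.7), citing
  D. Allcock, *New complex- and quaternion-hyperbolic reflection groups*, Duke Math. J. 103 (2000),
  Thm 7.1, for the uniqueness of a unimodular Hermitian `𝓔`-lattice of signature `(4,1)`]:
  **`Λ(T) ≅ 𝓔^{4,1}`**.
* [AllcockCarlsonToledo2002, (2.12), Lemma 4.5, (3.12)]: `V := Λ/θΛ` is a `5`-dimensional
  `𝔽₃`-space on which `h` induces a nondegenerate quadratic form `q`; `Aut Λ → Aut(V, q)` and the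
  spinor norm `Aut(V, q) → {±1}` are onto; the central `-1 ∈ Aut(V, q) = O₅(3)` has spinor norm
  `-1`, and `P Aut(V) = PGO₅(3) ≅ W(E₆)` (ATLAS p. 26), i.e. `O₅(𝔽₃) = W(E₆) × {±1}`.
* [AllcockCarlsonToledo2002, (4.8)–(4.10), Lemma 3.13]: with `L₀(S) = η(S)^⊥ ≅ -E₆` in
  `L(S) = H²(S, ℤ) ≅ ℤ^{1,6}` and `V(S) := L₀(S)/3L₀'(S)` (the quadratic `𝔽₃`-space of the `27`
  lines, in this tree `CubicSurface.LinesQuadSpace`), there is an isometry `V(S) ≅ V(T)`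
  identifying the monodromy representations of `π₁` of the space of smooth cubic forms.
* [Achter2014, §2, §4.2, Lemma 4.4, Prop 4.5] (algebraic, over `𝓞_E[1/6]`; the stack-theoretic
  correction is [Achter2020, §7.7, Prop 7.13]): `ℤ[ζ₃]` acts on the Prym/intermediate Jacobian
  `P = P(T_S)` (a principally polarised abelian fivefold, signature `(4,1)`); for two lines
  `L₁, L₂ ⊆ S` the class `α([L̃₁] - [L̃₂])` lies in `P[1 - ζ₃]`, and for a marked cubic surface the
  five classes `α([e_i] - [ℓ_{i6}])` form an orthonormal basis of the quadratic `𝔽₃`-space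
  `(P[1 - ζ₃], h̄_λ)`; the resulting morphism `𝓢^marked → 𝓜^{(1-ζ₃)}` is `W(E₆)`-equivariant and the
  occult period map `τ : 𝓢 → 𝓜` is a morphism of stacks over `𝓞_E[1/6]`.  In particular, for
  `S` over a field `k ⊇ ℚ(ω)`, **`P[1-ζ₃](k̄) ≅ V(S_{k̄})` `Gal(k̄/k)`-equivariantly**, as quadratic
  `𝔽₃`-spaces spanned by differences of lines.

## What is formalized here, and the conventions

The tree has no carrier for `H³(T_S)` (singular or étale cohomology of a hypersurface), so the
lattice statements above are recorded, with locators, in this docstring only.  What the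
requesting route (Langlands/`CubicSurfaceE6Transport`, crux `OccultSystemIsE6Type`, definition
item `CubicSurface.occultCompatibleSystem`, option (A) "interface + nonemptiness as a named
fact") consumes is the **λ-adic shadow** of these results, which IS statable with the tree's
carriers `Literature.NumberTheory.GaloisRepresentations.CompatibleSystem` and
`CubicSurface.linesQuadRep`:

* `CubicSurface.IsOccultSystem F 𝓢` — the interface: `𝓢` is a rank-`5` compatible system over
  `K = ℚ(ω)` with coefficients in `E = ℚ(ω)` having the three properties of the system
  `v ↦ det(X - F_v | H³_ét(T_{S,K̄}, E_ℓ)_ω)`, **`F_v` the GEOMETRIC Frobenius** (equivalently, in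
  the tree's arithmetic-Frobenius convention `FramedGaloisRep.HasFrobCharpolyAt`, the system of
  the duals `(H³_ω)^∨ ≅ H³_ω̄(3)` restricted to `Γ_K`; the `ω`-eigenspace of `σ*` is `Γ_K`-stable
  because `σ` is defined over `K`):
  (purity) every complex root `z` of `charpoly v`, `v ∉ bad`, has `|z|² = (N v)³`
  [Deligne1974, Thm 1.6, for the smooth projective threefold `T_S` with good reduction at `v`];
  (polarisation, `a = 3`) at the conjugate place `w = v̄` the roots are `{(N v)³/β}` for `β` the
  roots at `v` — complex conjugation `c ∈ Γ_ℚ ∖ Γ_K` exchanges the `ω`- and `ω̄`-eigenspaces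
  (`cσc⁻¹ = σ⁻¹`), `Frob_{c𝔓} = c Frob_𝔓 c⁻¹`, and the cup product `H³_ω × H³_ω̄ → H⁶ = E_ℓ(-3)`
  is a perfect `Γ_K`-pairing (`H³_ω`, `H³_ω̄` are isotropic as `Ω(σx, σy) = Ω(x, y)`), so the
  geometric Frobenius eigenvalues on `H³_ω̄` at `v` are `(N v)³ β⁻¹` [AllcockCarlsonToledo2002,
  (2.3)–(2.4); KudlaRapoport2012, §5];
  (integrality and residual type mod `λ₃`) `charpoly v ∈ 𝓞_E[X]` (geometric Frobenius eigenvalues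
  on `H³_ét` are algebraic integers [Deligne1974, Thm 1.6]) and its reduction mod `λ₃ = (1-ω)` is
  the characteristic polynomial of `Frob_v` on the quadratic space `V(S)` of the `27` lines
  (`CubicSurface.linesQuadRep`, of dimension `5`): the `Γ_K`-stable `𝓞_{E,λ₃} = ℤ₃[ω]`-lattice
  `H³_ét(T_{S,K̄}, ℤ₃)_ω ≅ Λ(T) ⊗ ℤ₃` (comparison) has reduction `Λ/θΛ = V(T)`, which is
  `V(S)` `Γ_K`-equivariantly [AllcockCarlsonToledo2002, (4.8)–(4.10); Achter2014, Lemma 4.4,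
  Prop 4.5, with `P[1-ζ₃] = T₃P/(1-ζ₃)` and `T₃ P ≅ H³_ét(T, ℤ₃)` up to a Tate twist]; Tate twists
  and the sign `V(S) ≅ V(T) ⊗ (1 or ε̄)` are invisible on `Γ_K` modulo `λ₃` (the mod-`3` cyclotomic
  character is trivial on `Γ_{ℚ(ω)}`), and dualising does not change characteristic polynomials
  on the orthogonal space `(V(S), q)`; so the clause is insensitive to the choices `ω ↔ ω̄`,
  `H³_ω ↔ (H³_ω)^∨`.
* `CubicSurface.exists_occultSystem` — the NAMED FACT (nonemptiness of the interface for every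
  smooth cubic form over `ℚ`), the conjunction of the cited results as explained above.
* `CubicSurface.occultCompatibleSystem h F hF` — a chosen occult system (definition item
  `CubicSurface.occultCompatibleSystem`, option (A)), under the named fact `h`.

NOT asserted (depends on `S`, belongs to the route's crux): absolute irreducibility at `λ₃`,
surjectivity of `Gal(ℚ(lines)/ℚ) → W(E₆)`, the discriminant/spinor-parity condition relating
`linesQuadRep|Γ_K` to the `SO₅(𝔽₃)`-valued `linesOrthogonalRep` (they differ on `Γ_K` by the
quadratic character of `Δ(F)` [ElsenhansJahnel2011, Thm 2.12]), local types at `2, 3, ∞`.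

## References

* [AllcockCarlsonToledo2002] D. Allcock, J. Carlson, D. Toledo, *The complex hyperbolic geometry
  of the moduli space of cubic surfaces*, J. Algebraic Geom. 11 (2002) 659–724: (2.2)–(2.7),
  (2.12), Lemma 2.6, (3.12), Lemma 3.13, Lemma 4.1, Lemma 4.5, (4.8)–(4.10).
* [KudlaRapoport2012] S. Kudla, M. Rapoport, *On occult period maps*, Pacific J. Math. 260 (2012)
  565–582: §5 (Fact, (5.1)–(5.2), Thm 5.1).
* [Achter2014] J. Achter, *Arithmetic Torelli maps for cubic surfaces and threefolds*, Trans. AMS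
  366 (2014) 5749–5769: §2, Lemma 4.1, Lemma 4.3, §4.2, Lemma 4.4, Prop 4.5.
* [Achter2020] J. Achter, *Arithmetic occult period maps*, Algebraic Geometry 7 (2020) 581–606:
  §7.7, Prop 7.13.
* [Deligne1974] P. Deligne, *La conjecture de Weil. I*, Publ. Math. IHÉS 43 (1974): Thm 1.6.
* [ElsenhansJahnel2011] A.-S. Elsenhans, J. Jahnel, *The discriminant of a cubic surface*,
  Geom. Dedicata (2011): Thm 2.12.
-/

noncomputable section

open Polynomial NumberField IsDedekindDomain Field
open Literature.NumberTheory.GaloisRepresentations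

namespace Literature.AlgebraicGeometry.CubicSurfaces

namespace CubicSurface

/-- **Interface: `𝓢` is an occult compatible system of the cubic form `F` over `ℚ`.**
`𝓢` is a rank-`5` compatible system over `K = ℚ(ω)` with coefficients in `E = ℚ(ω)` (tree
`CompatibleSystem`, ARITHMETIC Frobenius) with the three properties of the system of
characteristic polynomials of GEOMETRIC Frobenius on the `ω`-eigenspace `H³_ét(T_{S,K̄}, E_ℓ)_ω`
of the cyclic cubic threefold `T_S : Y³ = F` (equivalently of the `Γ_K`-representations
`(H³_ω)^∨`), see the module docstring for the derivation of each clause and its insensitivity to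
the conventions:
1. (purity, weight `3`) for `v ∉ 𝓢.bad` every complex root `z` of `𝓢.charpoly v` under every
   `E →+* ℂ` has `‖z‖² = (N v)³` [Deligne1974, Thm 1.6];
2. (polarisation, exponent `a = 3`) for the nontrivial `τ ∈ Gal(K/ℚ)` and good places `v`,
   `w = τ⁻¹ v`: `𝓢.charpoly w = ∏ (X - (N v)³ β⁻¹)` over the roots `β` of `𝓢.charpoly v`, written
   as the monic `(N v)³`-reciprocal transform (Poincaré duality `H³_ω × H³_ω̄ → E_ℓ(-3)` and
   `c H³_ω = H³_ω̄`) [AllcockCarlsonToledo2002, (2.3)–(2.4); KudlaRapoport2012, §5];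
3. (integrality and occult residual type) there are a prime `λ` of `𝓞_E` containing `3`
   (necessarily `λ₃ = (1 - ω)`), `j : 𝔽₃ → 𝓞_E/λ`, and a basis `b` of the quadratic `𝔽₃`-space
   `V(S)` of the `27` lines over `ℚ̄` indexed by `Fin 5` (`dim V(S) = 5`), such that for every
   `v ∉ 𝓢.bad`, `𝓢.charpoly v = P₀ ∈ 𝓞_E[X]` and for every Frobenius `σ ∈ Γ_K` at a prime above
   `v`, `P₀ mod λ = det(X - σ | V(S))`, `σ` acting on `V(S)` through
   `absGaloisRestrict ℚ K : Γ_K → Γ_ℚ` and `CubicSurface.linesQuadRep` — the reduction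
   `Λ(T)/(1-ω)Λ(T) = V(T) ≅ V(S)` of the occult Eisenstein lattice `Λ(T) = H³(T, ℤ) ≅ ℤ[ω]^{4,1}`
   [AllcockCarlsonToledo2002, (2.2), (2.7), (2.12), (4.8)–(4.10); Achter2014, Lemma 4.4, Prop 4.5].
[cite: AllcockCarlsonToledo2002, (2.2)–(2.7), (2.12), (4.8)–(4.10)]
[cite: Achter2014, Lemma 4.4, Prop 4.5] -/
def IsOccultSystem (F : MvPolynomial (Fin 4) ℚ)
    (𝓢 : CompatibleSystem (CyclotomicField 3 ℚ) (CyclotomicField 3 ℚ) 5) : Prop :=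
  -- (1) purity of weight 3: |root|² = (N v)³ under every complex embedding
  (∀ v : HeightOneSpectrum (𝓞 (CyclotomicField 3 ℚ)), v ∉ 𝓢.bad →
    ∀ (emb : (CyclotomicField 3 ℚ) →+* ℂ) (z : ℂ), ((𝓢.charpoly v).map emb).IsRoot z →
      ‖z‖ ^ 2 = (v.residueCard : ℝ) ^ 3) ∧
  -- (2) polarisation with exponent a = 3 (conjugate place ↦ monic (N v)³-reciprocal transform)
  (∀ τ : (CyclotomicField 3 ℚ) ≃ₐ[ℚ] (CyclotomicField 3 ℚ), τ ≠ AlgEquiv.refl →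
    ∀ v w : HeightOneSpectrum (𝓞 (CyclotomicField 3 ℚ)), v ∉ 𝓢.bad → w ∉ 𝓢.bad →
      w.asIdeal = Ideal.comap (RingOfIntegers.mapRingHom τ.toRingEquiv.toRingHom) v.asIdeal →
      𝓢.charpoly w = C ((𝓢.charpoly v).coeff 0)⁻¹ *
        ((𝓢.charpoly v).comp (C ((v.residueCard : (CyclotomicField 3 ℚ)) ^ 3) * X)).reverse) ∧
  -- (3) integrality and occult residual type modulo λ₃ = (1 - ω): reduction = the 27-line
  --     quadratic space V(S) restricted to Γ_K
  (∃ («λ» : HeightOneSpectrum (𝓞 (CyclotomicField 3 ℚ)))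
      (j : ZMod 3 →+* 𝓞 (CyclotomicField 3 ℚ) ⧸ «λ».asIdeal)
      (b : Module.Basis (Fin 5) (ZMod 3) (LinesQuadSpace (AlgebraicClosure ℚ) F)),
    (3 : 𝓞 (CyclotomicField 3 ℚ)) ∈ «λ».asIdeal ∧
    ∀ v : HeightOneSpectrum (𝓞 (CyclotomicField 3 ℚ)), v ∉ 𝓢.bad →
      ∃ P₀ : Polynomial (𝓞 (CyclotomicField 3 ℚ)),
        P₀.map (algebraMap (𝓞 (CyclotomicField 3 ℚ)) (CyclotomicField 3 ℚ)) = 𝓢.charpoly v ∧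
        ∀ 𝔓 ∈ v.primesAbove, ∀ σ : absoluteGaloisGroup (CyclotomicField 3 ℚ),
          IsArithFrobAt (𝓞 (CyclotomicField 3 ℚ)) σ 𝔓 →
          (LinearMap.toMatrix b b (linesQuadRep (AlgebraicClosure ℚ) F
              (absGaloisRestrict ℚ (CyclotomicField 3 ℚ) σ))).charpoly.map j =
            P₀.map (Ideal.Quotient.mk «λ».asIdeal))

variable {F : MvPolynomial (Fin 4) ℚ}
  {𝓢 : CompatibleSystem (CyclotomicField 3 ℚ) (CyclotomicField 3 ℚ) 5}

/-- Purity clause of an occult system (weight `3`). [cite: Deligne1974, Thm 1.6] -/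
theorem IsOccultSystem.pure (h : IsOccultSystem F 𝓢)
    {v : HeightOneSpectrum (𝓞 (CyclotomicField 3 ℚ))} (hv : v ∉ 𝓢.bad)
    (emb : (CyclotomicField 3 ℚ) →+* ℂ) {z : ℂ} (hz : ((𝓢.charpoly v).map emb).IsRoot z) :
    ‖z‖ ^ 2 = (v.residueCard : ℝ) ^ 3 :=
  h.1 v hv emb z hz

/-- Polarisation clause of an occult system (exponent `a = 3`); the route's shape
`∃ a : ℤ, …` is obtained with `a = 3`. [cite: AllcockCarlsonToledo2002, (2.3)–(2.4)] -/
theorem IsOccultSystem.polarised (h : IsOccultSystem F 𝓢)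
    {τ : (CyclotomicField 3 ℚ) ≃ₐ[ℚ] (CyclotomicField 3 ℚ)} (hτ : τ ≠ AlgEquiv.refl)
    {v w : HeightOneSpectrum (𝓞 (CyclotomicField 3 ℚ))} (hv : v ∉ 𝓢.bad) (hw : w ∉ 𝓢.bad)
    (hvw : w.asIdeal = Ideal.comap (RingOfIntegers.mapRingHom τ.toRingEquiv.toRingHom) v.asIdeal) :
    𝓢.charpoly w = C ((𝓢.charpoly v).coeff 0)⁻¹ *
      ((𝓢.charpoly v).comp (C ((v.residueCard : (CyclotomicField 3 ℚ)) ^ 3) * X)).reverse :=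
  h.2.1 τ hτ v w hv hw hvw

/-- Residual clause of an occult system: integrality of the Frobenius polynomials and their
reduction mod `λ₃ = (1 - ω)` to the `27`-line quadratic representation on `Γ_K`-Frobenii.
[cite: AllcockCarlsonToledo2002, (4.8)–(4.10)] [cite: Achter2014, Lemma 4.4, Prop 4.5] -/
theorem IsOccultSystem.residual (h : IsOccultSystem F 𝓢) :
    ∃ («λ» : HeightOneSpectrum (𝓞 (CyclotomicField 3 ℚ)))
      (j : ZMod 3 →+* 𝓞 (CyclotomicField 3 ℚ) ⧸ «λ».asIdeal)
      (b : Module.Basis (Fin 5) (ZMod 3) (LinesQuadSpace (AlgebraicClosure ℚ) F)),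
    (3 : 𝓞 (CyclotomicField 3 ℚ)) ∈ «λ».asIdeal ∧
    ∀ v : HeightOneSpectrum (𝓞 (CyclotomicField 3 ℚ)), v ∉ 𝓢.bad →
      ∃ P₀ : Polynomial (𝓞 (CyclotomicField 3 ℚ)),
        P₀.map (algebraMap (𝓞 (CyclotomicField 3 ℚ)) (CyclotomicField 3 ℚ)) = 𝓢.charpoly v ∧
        ∀ 𝔓 ∈ v.primesAbove, ∀ σ : absoluteGaloisGroup (CyclotomicField 3 ℚ),
          IsArithFrobAt (𝓞 (CyclotomicField 3 ℚ)) σ 𝔓 →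
          (LinearMap.toMatrix b b (linesQuadRep (AlgebraicClosure ℚ) F
              (absGaloisRestrict ℚ (CyclotomicField 3 ℚ) σ))).charpoly.map j =
            P₀.map (Ideal.Quotient.mk «λ».asIdeal) :=
  h.2.2

/-- In particular the quadratic `𝔽₃`-space `V(S)` of the lines of a cubic form carrying an occult
system is `5`-dimensional (`27` lines, `K_S^⊥ ≅ E₆(-1)` of discriminant `3`).
[cite: AllcockCarlsonToledo2002, (4.8)] -/
theorem IsOccultSystem.finrank_linesQuadSpace (h : IsOccultSystem F 𝓢) :
    Module.finrank (ZMod 3) (LinesQuadSpace (AlgebraicClosure ℚ) F) = 5 := by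
  obtain ⟨_, _, b, -, -⟩ := h.2.2
  simpa using Module.finrank_eq_card_basis b

/-- **The occult compatible system of a smooth cubic surface exists** (named fact; the
nonemptiness of the interface `IsOccultSystem`).  For every smooth cubic form `F` over `ℚ`
(`CubicSurface.IsSmoothCubic`), the `ω`-eigenspace of the deck transformation on the third
cohomology of the cyclic cubic threefold `T_S : Y³ = F` — the occult Eisenstein lattice
`Λ(T) = H³(T, ℤ) ≅ ℤ[ω]^{4,1}` of signature `(4,1)` [AllcockCarlsonToledo2002, (2.2), Lemma 2.6,
(2.7); KudlaRapoport2012, §5 Fact] and its `ℓ`-adic realisations — gives a rank-`5` compatible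
system over `K = ℚ(ω)` with coefficients in `ℚ(ω)` which is pure of weight `3` [Deligne1974,
Thm 1.6], polarised with exponent `3` (Poincaré duality pairing the `ω`- and `ω̄`-eigenspaces,
exchanged by complex conjugation), with `𝓞_E`-integral Frobenius polynomials whose reduction
modulo `λ₃ = (1 - ω)` is the characteristic polynomial of Frobenius on the `5`-dimensional
quadratic `𝔽₃`-space of the `27` lines: `Λ(T)/(1-ω)Λ(T) = V(T) ≅ V(S)`, `Γ_K`-equivariantly
[AllcockCarlsonToledo2002, (2.12), (4.8)–(4.10), Lemma 3.13; Achter2014, §4.2, Lemma 4.4,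
Prop 4.5 (the occult period map and the level-`(1-ζ₃)` structure of the `27` lines are defined
over `𝓞_E[1/6]`); Achter2020, Prop 7.13].  See the module docstring for the exact conventions
(member `(H³_ω)^∨`, arithmetic Frobenius) and why the residual clause does not depend on them.
[cite: AllcockCarlsonToledo2002, (2.2), (2.7), (2.12), (4.8)–(4.10)]
[cite: Achter2014, Lemma 4.4, Prop 4.5] [cite: Deligne1974, Thm 1.6] -/
def exists_occultSystem : Prop :=
  ∀ F : MvPolynomial (Fin 4) ℚ, IsSmoothCubic F →
    ∃ 𝓢 : CompatibleSystem (CyclotomicField 3 ℚ) (CyclotomicField 3 ℚ) 5, IsOccultSystem F 𝓢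

/-- **The occult compatible system** of a smooth cubic form `F` over `ℚ` (a CHOSEN witness of the
named fact `exists_occultSystem`, option (A) of the definition item
`CubicSurface.occultCompatibleSystem`): a rank-`5` compatible system over `ℚ(ω)` with
coefficients in `ℚ(ω)` satisfying `IsOccultSystem F` — the `λ`-adic realisations of
`H³(T_S)_ω`, recorded through their Frobenius polynomials.  Well defined only up to the
interface (any two witnesses have the same `charpoly` off their bad sets only insofar as the
interface pins them; the geometric system is the intended one).
[cite: AllcockCarlsonToledo2002, (2.2), (2.7)] [cite: Achter2014, Prop 4.5] -/
def occultCompatibleSystem (h : exists_occultSystem) (F : MvPolynomial (Fin 4) ℚ)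
    (hF : IsSmoothCubic F) : CompatibleSystem (CyclotomicField 3 ℚ) (CyclotomicField 3 ℚ) 5 :=
  (h F hF).choose

/-- The chosen occult system satisfies the interface. [cite: Achter2014, Prop 4.5] -/
theorem isOccultSystem_occultCompatibleSystem (h : exists_occultSystem) (F : MvPolynomial (Fin 4) ℚ)
    (hF : IsSmoothCubic F) : IsOccultSystem F (occultCompatibleSystem h F hF) :=
  (h F hF).choose_spec

end CubicSurface

end Literature.AlgebraicGeometry.CubicSurfaces

end
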